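import Summits.Ventures.HodgeRepro2.T5SU11ResolventEnergyPieces
import Summits.Ventures.HodgeRepro2.T5SU11RadialGreenSymmetric

/-!
# The energy identity of the resolvent: `⟨G_λ f, f⟩ = −‖(G_λ f)′‖² − λ(λ−2) ‖G_λ f‖²` in `L²(sinh 2t dt)`

For `λ > 1` and a continuous source `f` supported in `[a, b] ⊂ (0, ∞)`, `u = G_λ f` satisfies the energy identity of
row 474 on `[ε, R]`, `∫_ε^R (sinh 2t (u′)² + μ sinh 2t u² + sinh 2t f u) = E(R) − E(ε)` (`energy_identity_resolvent`;
the source term is `∫_a^b sinh 2t f u`). Letting `ε → 0⁺` (`E(ε) → 0`, `∫_0^ε → 0`; `energy_identity_finite`) and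
`R → ∞` (`E(R) → 0` by row 473, `∫_0^R sinh 2t u² → ∫_0^∞` by the integrability of row 474, and the non-negative
integrand `sinh 2t (u′)²` then has a convergent integral, hence is integrable on `(0, ∞)`:
`integrableOn_sinh_mul_sphGreen'_sq`):

  **`∫_0^∞ sinh 2t (G_λ f)′² + λ(λ−2) ∫_0^∞ sinh 2t (G_λ f)² = −∫_a^b sinh 2t f · G_λ f`**  (`energy_identity`),

i.e. `⟨G_λ f, f⟩ = −‖(G_λ f)′‖² − λ(λ−2)‖G_λ f‖²` for the pairing `⟨u, v⟩ = ∫_0^∞ u v sinh 2t dt`. Consequently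
**the quadratic form of the resolvent is non-positive for `λ ≥ 2`**: `⟨G_λ f, f⟩ ≤ 0` (`inner_sphGreen_nonpos`,
`inner_sphGreen_nonpos_Ioi`) — for sources of arbitrary sign, refining row 465's `f ≥ 0 ⇒ G_λ f ≤ 0`. Nothing is
claimed about (N).

Blind lane: Mathlib + the HodgeRepro2 prefix only; no sorry; axioms ⊆ {propext, Classical.choice,
Quot.sound}.
-/

namespace Summit.Ventures.HodgeRepro2.T5SU11ResolventEnergy

open Filter Topology MeasureTheory intervalIntegral
open Set (Ioi Ioc Icc uIcc)
open T5SU11Cartan T5SU11SphericalFunction T5SU11SphericalBounds T5SU11SphericalContinuous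
  T5SU11SphericalSolutionSpaceAll T5SU11SphericalDecay T5SU11RadialGreen T5SU11SphericalGreen
  T5SU11ResolventTransform T5SU11SphericalDecayBracket T5SU11ResolventEnergyPieces T5SU11RadialGreenSymmetric

section measure

variable [MeasurableSpace Circle] [BorelSpace Circle]

variable {lam a b : ℝ} {f : ℝ → ℝ} (hlam : 1 < lam) (hf : ContinuousOn f (Ioi 0))
  (ha : 0 < a) (hab : a ≤ b) (hfa : ∀ s, s ≤ a → f s = 0) (hfb : ∀ s, b ≤ s → f s = 0)

/-! ### The identity on `[ε, R]` -/

include hlam hf ha hab hfa hfb in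
/-- **The energy identity for `u = G_λ f` on `[ε, R]`**, `0 < ε ≤ a`, `b ≤ R`:
`∫_ε^R sinh 2t (u′)² + μ ∫_ε^R sinh 2t u² + ∫_a^b sinh 2t f u = E(R) − E(ε)`. -/
theorem energy_identity_resolvent {ε R : ℝ} (hε : 0 < ε) (hεa : ε ≤ a) (hbR : b ≤ R) :
    (∫ t in ε..R, Real.sinh (2 * t) * sphGreen' lam f a b t ^ 2) + lam * (lam - 2) * (∫ t in ε..R, Real.sinh (2 * t) * sphGreen lam f a b t ^ 2)
        + ∫ t in a..b, Real.sinh (2 * t) * (f t * sphGreen lam f a b t)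
      = Real.sinh (2 * R) * (sphGreen lam f a b R * sphGreen' lam f a b R) - Real.sinh (2 * ε) * (sphGreen lam f a b ε * sphGreen' lam f a b ε) := by
  have hb : 0 < b := lt_of_lt_of_le ha hab
  have hR : 0 < R := lt_of_lt_of_le hb hbR
  have hεR : ε ≤ R := le_trans hεa (le_trans hab hbR)
  have h := energy_identity_inhom (μ := lam * (lam - 2)) (u := sphGreen lam f a b) (u' := sphGreen' lam f a b)
    (u'' := sphGreen'' lam f a b) (f := f) (fun t ht => hasDerivAt_sphGreen hlam hf ha hab ht)
    (fun t ht => hasDerivAt_sphGreen' hlam hf ha hab ht) (fun t ht => sphGreen_ode hlam ht) hf hε hεR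
  rw [← h]
  have hsub : uIcc ε R ⊆ Ioi 0 := uIcc_subset_Ioi hε hR
  have hcu : ContinuousOn (sphGreen lam f a b) (Ioi 0) :=
    fun t ht => (hasDerivAt_sphGreen hlam hf ha hab ht).continuousAt.continuousWithinAt
  have hcs : ContinuousOn (fun t => Real.sinh (2 * t)) (Ioi 0) :=
    (Real.continuous_sinh.comp (continuous_const.mul continuous_id)).continuousOn
  have hA : IntervalIntegrable (fun t => Real.sinh (2 * t) * sphGreen' lam f a b t ^ 2) volume ε R :=
    ((continuousOn_sinh_mul_sphGreen'_sq hlam hf ha hab).mono hsub).intervalIntegrable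
  have hB : IntervalIntegrable (fun t => Real.sinh (2 * t) * sphGreen lam f a b t ^ 2) volume ε R :=
    ((continuousOn_sinh_mul_sphGreen_sq hlam hf ha hab).mono hsub).intervalIntegrable
  have hC : ContinuousOn (fun t => Real.sinh (2 * t) * (f t * sphGreen lam f a b t)) (Ioi 0) := hcs.mul (hf.mul hcu)
  have hCi : IntervalIntegrable (fun t => Real.sinh (2 * t) * (f t * sphGreen lam f a b t)) volume ε R := (hC.mono hsub).intervalIntegrable
  rw [integral_add (hA.add (hB.const_mul _)) hCi, integral_add hA (hB.const_mul _), intervalIntegral.integral_const_mul]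
  congr 1
  -- the source term is an integral over `[a, b]`
  have hi1 : IntervalIntegrable (fun t => Real.sinh (2 * t) * (f t * sphGreen lam f a b t)) volume ε a :=
    (hC.mono (uIcc_subset_Ioi hε ha)).intervalIntegrable
  have hi2 : IntervalIntegrable (fun t => Real.sinh (2 * t) * (f t * sphGreen lam f a b t)) volume a b :=
    (hC.mono (uIcc_subset_Ioi ha hb)).intervalIntegrable
  have hi3 : IntervalIntegrable (fun t => Real.sinh (2 * t) * (f t * sphGreen lam f a b t)) volume b R :=
    (hC.mono (uIcc_subset_Ioi hb hR)).intervalIntegrable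
  have hz1 : ∫ t in ε..a, Real.sinh (2 * t) * (f t * sphGreen lam f a b t) = 0 := by
    refine (integral_congr (g := fun _ => (0 : ℝ)) fun t ht => ?_).trans integral_zero
    rw [Set.uIcc_of_le hεa] at ht
    simp only [hfa t ht.2, zero_mul, mul_zero]
  have hz3 : ∫ t in b..R, Real.sinh (2 * t) * (f t * sphGreen lam f a b t) = 0 := by
    refine (integral_congr (g := fun _ => (0 : ℝ)) fun t ht => ?_).trans integral_zero
    rw [Set.uIcc_of_le hbR] at ht
    simp only [hfb t ht.1, zero_mul, mul_zero]
  rw [← integral_add_adjacent_intervals hi1 (hi2.trans hi3), ← integral_add_adjacent_intervals hi2 hi3,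
    hz1, hz3, zero_add, add_zero]

/-! ### `ε → 0⁺` -/

include hlam hf ha hab hfa in
/-- `∫_0^ε sinh 2t (u′)² → 0` as `ε → 0⁺`. -/
theorem tendsto_integral_sinh_mul_sphGreen'_sq_nhdsGT_zero :
    Tendsto (fun ε => ∫ t in (0 : ℝ)..ε, Real.sinh (2 * t) * sphGreen' lam f a b t ^ 2) (𝓝[>] 0) (𝓝 0) := by
  set c₁ := ∫ s in a..b, sphDecay lam s * f s * Real.sinh (2 * s) with hc₁
  have h1 : Continuous (deriv fun t => sph lam (hyp t)) :=
    continuous_iff_continuousAt.mpr fun t => (hasDerivAt_deriv_sph_hyp lam t).continuousAt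
  have hg : Continuous fun t => Real.sinh (2 * t) * (-c₁ * deriv (fun t => sph lam (hyp t)) t) ^ 2 :=
    (Real.continuous_sinh.comp (continuous_const.mul continuous_id)).mul ((continuous_const.mul h1).pow 2)
  refine tendsto_integral_nhdsGT_zero_of_eqOn hg ha (fun t ht hta => ?_)
  rw [(sphGreen_of_le (lam := lam) (lam' := (1 + lam) / 2) (by linarith) (by linarith) hf ha hab hfa ht hta).2]

include hlam hf ha hab hfa in
/-- `∫_0^ε sinh 2t u² → 0` as `ε → 0⁺`. -/
theorem tendsto_integral_sinh_mul_sphGreen_sq_nhdsGT_zero :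
    Tendsto (fun ε => ∫ t in (0 : ℝ)..ε, Real.sinh (2 * t) * sphGreen lam f a b t ^ 2) (𝓝[>] 0) (𝓝 0) := by
  set c₁ := ∫ s in a..b, sphDecay lam s * f s * Real.sinh (2 * s) with hc₁
  have hg : Continuous fun t => Real.sinh (2 * t) * (-c₁ * sph lam (hyp t)) ^ 2 :=
    (Real.continuous_sinh.comp (continuous_const.mul continuous_id)).mul
      ((continuous_const.mul (continuous_sph_hyp lam)).pow 2)
  refine tendsto_integral_nhdsGT_zero_of_eqOn hg ha (fun t ht hta => ?_)
  rw [(sphGreen_of_le (lam := lam) (lam' := (1 + lam) / 2) (by linarith) (by linarith) hf ha hab hfa ht hta).1]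

include hlam hf ha hab hfa hfb in
/-- **The energy identity on `[0, R]`**, `b ≤ R`:
`∫_0^R sinh 2t (u′)² + μ ∫_0^R sinh 2t u² + ∫_a^b sinh 2t f u = E(R)`. -/
theorem energy_identity_finite {R : ℝ} (hbR : b ≤ R) :
    (∫ t in (0 : ℝ)..R, Real.sinh (2 * t) * sphGreen' lam f a b t ^ 2) + lam * (lam - 2) * (∫ t in (0 : ℝ)..R, Real.sinh (2 * t) * sphGreen lam f a b t ^ 2)
        + ∫ t in a..b, Real.sinh (2 * t) * (f t * sphGreen lam f a b t)
      = Real.sinh (2 * R) * (sphGreen lam f a b R * sphGreen' lam f a b R) := by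
  have hb : 0 < b := lt_of_lt_of_le ha hab
  have hR : 0 < R := lt_of_lt_of_le hb hbR
  have hAint : ∀ c, 0 ≤ c → IntervalIntegrable (fun t => Real.sinh (2 * t) * sphGreen' lam f a b t ^ 2) volume 0 c := fun c hc =>
    (intervalIntegrable_iff_integrableOn_Ioc_of_le hc).mpr (integrableOn_sinh_mul_sphGreen'_sq_Ioc hlam hf ha hab hfa c)
  have hBint : ∀ c, 0 ≤ c → IntervalIntegrable (fun t => Real.sinh (2 * t) * sphGreen lam f a b t ^ 2) volume 0 c := fun c hc =>
    (intervalIntegrable_iff_integrableOn_Ioc_of_le hc).mpr (integrableOn_sinh_mul_sphGreen_sq_Ioc hlam hf ha hab hfa c)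
  -- the right side of the identity on `[ε, R]` tends to `E(R)`
  have hconst : Tendsto (fun ε => Real.sinh (2 * R) * (sphGreen lam f a b R * sphGreen' lam f a b R) - Real.sinh (2 * ε) * (sphGreen lam f a b ε * sphGreen' lam f a b ε)) (𝓝[>] 0) (𝓝 (Real.sinh (2 * R) * (sphGreen lam f a b R * sphGreen' lam f a b R) - 0)) :=
    tendsto_const_nhds.sub (tendsto_energy_bracket_left hlam hf ha hab hfa)
  -- the left side tends to the `[0, R]` expression
  have hA : Tendsto (fun ε => (∫ t in (0 : ℝ)..R, Real.sinh (2 * t) * sphGreen' lam f a b t ^ 2) - ∫ t in (0 : ℝ)..ε, Real.sinh (2 * t) * sphGreen' lam f a b t ^ 2) (𝓝[>] 0)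
      (𝓝 ((∫ t in (0 : ℝ)..R, Real.sinh (2 * t) * sphGreen' lam f a b t ^ 2) - 0)) :=
    tendsto_const_nhds.sub (tendsto_integral_sinh_mul_sphGreen'_sq_nhdsGT_zero hlam hf ha hab hfa)
  have hB : Tendsto (fun ε => (∫ t in (0 : ℝ)..R, Real.sinh (2 * t) * sphGreen lam f a b t ^ 2) - ∫ t in (0 : ℝ)..ε, Real.sinh (2 * t) * sphGreen lam f a b t ^ 2) (𝓝[>] 0)
      (𝓝 ((∫ t in (0 : ℝ)..R, Real.sinh (2 * t) * sphGreen lam f a b t ^ 2) - 0)) :=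
    tendsto_const_nhds.sub (tendsto_integral_sinh_mul_sphGreen_sq_nhdsGT_zero hlam hf ha hab hfa)
  have hlim := (hA.add (hB.const_mul (lam * (lam - 2)))).add
    (tendsto_const_nhds (x := ∫ t in a..b, Real.sinh (2 * t) * (f t * sphGreen lam f a b t)))
  have heq : (fun ε => ((∫ t in (0 : ℝ)..R, Real.sinh (2 * t) * sphGreen' lam f a b t ^ 2) - ∫ t in (0 : ℝ)..ε, Real.sinh (2 * t) * sphGreen' lam f a b t ^ 2)
        + lam * (lam - 2) * ((∫ t in (0 : ℝ)..R, Real.sinh (2 * t) * sphGreen lam f a b t ^ 2) - ∫ t in (0 : ℝ)..ε, Real.sinh (2 * t) * sphGreen lam f a b t ^ 2)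
        + ∫ t in a..b, Real.sinh (2 * t) * (f t * sphGreen lam f a b t))
      =ᶠ[𝓝[>] 0] (fun ε => Real.sinh (2 * R) * (sphGreen lam f a b R * sphGreen' lam f a b R) - Real.sinh (2 * ε) * (sphGreen lam f a b ε * sphGreen' lam f a b ε)) := by
    filter_upwards [Ioo_mem_nhdsGT ha] with ε hε
    rw [integral_interval_sub_left (hAint R hR.le) (hAint ε hε.1.le),
      integral_interval_sub_left (hBint R hR.le) (hBint ε hε.1.le)]
    exact energy_identity_resolvent hlam hf ha hab hfa hfb hε.1 hε.2.le hbR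
  have := tendsto_nhds_unique_of_eventuallyEq hlim hconst heq
  simp only [sub_zero] at this
  exact this

/-! ### `R → ∞` -/

include hlam hf ha hab hfa hfb in
/-- `∫_0^R sinh 2t (u′)² → −μ ∫_0^∞ sinh 2t u² − ∫_a^b sinh 2t f u` as `R → ∞`. -/
theorem tendsto_integral_sinh_mul_sphGreen'_sq_atTop :
    Tendsto (fun R => ∫ t in (0 : ℝ)..R, Real.sinh (2 * t) * sphGreen' lam f a b t ^ 2) atTop
      (𝓝 (0 - lam * (lam - 2) * (∫ t in Ioi 0, Real.sinh (2 * t) * sphGreen lam f a b t ^ 2) - ∫ t in a..b, Real.sinh (2 * t) * (f t * sphGreen lam f a b t))) := by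
  have hB := (intervalIntegral_tendsto_integral_Ioi 0 (integrableOn_sinh_mul_sphGreen_sq hlam hf ha hab hfa hfb)
    tendsto_id).const_mul (lam * (lam - 2))
  have h := ((tendsto_energy_bracket_right hlam hf ha hab hfb).sub hB).sub
    (tendsto_const_nhds (x := ∫ t in a..b, Real.sinh (2 * t) * (f t * sphGreen lam f a b t)))
  refine h.congr' ?_
  filter_upwards [eventually_ge_atTop b] with R hR
  have := energy_identity_finite hlam hf ha hab hfa hfb hR
  simp only [id]
  linarith

include hlam hf ha hab hfa hfb in
/-- **`sinh 2t (G_λ f)′²` is integrable on `(0, ∞)`** (a non-negative integrand with a convergent integral). -/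
theorem integrableOn_sinh_mul_sphGreen'_sq :
    IntegrableOn (fun t => Real.sinh (2 * t) * sphGreen' lam f a b t ^ 2) (Ioi 0) := by
  refine integrableOn_Ioi_of_intervalIntegral_norm_tendsto (l := atTop) (b := id) _ 0
    (fun R => integrableOn_sinh_mul_sphGreen'_sq_Ioc hlam hf ha hab hfa R) tendsto_id
    ((tendsto_integral_sinh_mul_sphGreen'_sq_atTop hlam hf ha hab hfa hfb).congr' ?_)
  filter_upwards [eventually_ge_atTop 0] with R hR
  simp only [id]
  refine integral_congr (fun t ht => ?_)
  rw [Set.uIcc_of_le hR] at ht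
  rw [Real.norm_eq_abs, abs_of_nonneg (mul_nonneg (Real.sinh_nonneg_iff.mpr (by linarith [ht.1])) (sq_nonneg _))]

include hlam hf ha hab hfa hfb in
/-- **The energy identity of the resolvent**:
`∫_0^∞ sinh 2t (G_λ f)′² + λ(λ−2) ∫_0^∞ sinh 2t (G_λ f)² = −∫_a^b sinh 2t f · G_λ f`. -/
theorem energy_identity :
    (∫ t in Ioi 0, Real.sinh (2 * t) * sphGreen' lam f a b t ^ 2) + lam * (lam - 2) * (∫ t in Ioi 0, Real.sinh (2 * t) * sphGreen lam f a b t ^ 2)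
      = -∫ t in a..b, Real.sinh (2 * t) * (f t * sphGreen lam f a b t) := by
  have h1 := intervalIntegral_tendsto_integral_Ioi 0 (integrableOn_sinh_mul_sphGreen'_sq hlam hf ha hab hfa hfb)
    (tendsto_id (x := atTop))
  have h2 := tendsto_integral_sinh_mul_sphGreen'_sq_atTop hlam hf ha hab hfa hfb
  have := tendsto_nhds_unique h1 h2
  linarith

/-! ### The quadratic form is non-positive for `λ ≥ 2` -/

include hlam hf ha hab hfa hfb in
/-- **`⟨G_λ f, f⟩ ≤ 0` for `λ ≥ 2`**: `∫_a^b f · G_λ f · sinh 2t ≤ 0` for sources of arbitrary sign. -/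
theorem inner_sphGreen_nonpos (h2 : 2 ≤ lam) :
    ∫ t in a..b, f t * sphGreen lam f a b t * Real.sinh (2 * t) ≤ 0 := by
  have hE := energy_identity hlam hf ha hab hfa hfb
  have hA : 0 ≤ ∫ t in Ioi 0, Real.sinh (2 * t) * sphGreen' lam f a b t ^ 2 :=
    setIntegral_nonneg measurableSet_Ioi (fun t ht =>
      mul_nonneg (Real.sinh_nonneg_iff.mpr (by linarith [Set.mem_Ioi.mp ht])) (sq_nonneg _))
  have hB : 0 ≤ ∫ t in Ioi 0, Real.sinh (2 * t) * sphGreen lam f a b t ^ 2 :=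
    setIntegral_nonneg measurableSet_Ioi (fun t ht =>
      mul_nonneg (Real.sinh_nonneg_iff.mpr (by linarith [Set.mem_Ioi.mp ht])) (sq_nonneg _))
  have hμ : 0 ≤ lam * (lam - 2) := mul_nonneg (by linarith) (by linarith)
  have heq : ∫ t in a..b, f t * sphGreen lam f a b t * Real.sinh (2 * t) = ∫ t in a..b, Real.sinh (2 * t) * (f t * sphGreen lam f a b t) :=
    integral_congr (fun t _ => by ring)
  rw [heq]
  nlinarith [mul_nonneg hμ hB]

include hlam hf ha hab hfa hfb in
/-- **`⟨G_λ f, f⟩ ≤ 0` for `λ ≥ 2`, as the pairing over `(0, ∞)`.** -/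
theorem inner_sphGreen_nonpos_Ioi (h2 : 2 ≤ lam) :
    ∫ t in Ioi 0, sphGreen lam f a b t * f t * Real.sinh (2 * t) ≤ 0 := by
  rw [integral_Ioi_mul_eq_intervalIntegral ha hab hfa hfb]
  have := inner_sphGreen_nonpos hlam hf ha hab hfa hfb h2
  have heq : ∫ t in a..b, sphGreen lam f a b t * f t * Real.sinh (2 * t)
      = ∫ t in a..b, f t * sphGreen lam f a b t * Real.sinh (2 * t) :=
    integral_congr (fun t _ => by ring)
  rw [heq]
  exact this

end measure

end Summit.Ventures.HodgeRepro2.T5SU11ResolventEnergy
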